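import Summits.QuantumFields.YangMills.Theorems.BalabanUVNodesN09CentralWindowOpenMapping
import HarnessLib

/-!
# `FluctuationComparisonRegPrIntLWregChartChargeParam` — PARAMETRIC OPENNESS LETTERS and the JOINT inverse-function step of the (0.4) chart model
# (File 1 of the Theorems-side twin of CHARGE `ChartCharge`, LINE g18-2 `Cruxes/FluctuationComparisonRegPrIntL/Lines/wreg_chart.lean`, organ WREG of crux stmt-QuantumFields-20520)

Cell `ym3-torus` (HUMAN RULING D-0037: YM₃ on T³ is ladder rung R3 — NOT d = 4, NOT infinite volume, NOT a mass gap, NOT the Clay problem); width seat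
`ym-ust-20520-w3` gen 13; `--supports stmt-QuantumFields-20520 --as helper` (count-neutral).  THEOREMS ONLY (0 `def`, 0 `sorry`, default heartbeats).
LINE OWNER word: ideator ym-r3-idea-1 g18 «CHARGE → w3-20520 g13: GO» (ym3-torus STATUS 2026-08-29T14:51:43Z); ★★OWNER ym3-torus-plan g31 WORD 26 (B).

WHY.  CHARGE (`wreg_chart.lean` v15 :2327, stub `stub_chartCharge`) asks: if the leaf `{Ū⁽ᴷ⁻ᴶ⁾ = W}` meets the INTERIOR of the UV-small-history event
`histGood`, then the environments `z` whose off-pivot coordinates extend, by some pivot values, to a point of that leaf inside `histGood` have POSITIVE product-Haar mass.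
The road (no degree theory, no `Classical.choice` chart): the one-bond (0.4) average `(U, g) ↦ Ū(U[β c ↦ g])(c)` is an OPEN MAP JOINTLY IN (ENVIRONMENT, PIVOT) at every
central-window point — i.e. targets near `Ū(U₀[β c ↦ g₀])(c)` are hit by pivots near `g₀` for EVERY environment near `U₀` (parametric solvability) — and parametric
openness composes along the triangular chain of the iterated averaging.  dag-n09-w6 g4's ✓`…N09CentralWindowOpenMapping.map_nhds_oneVariable_eq_of_mem_centralWindow` is the
FIXED-environment statement; this file and its sequel `…WregChartChargeOneStep` carry the environment as a parameter through the same chart model.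

THIS FILE (generic topological spaces ∕ generic `(P, j, N)`):
* §1 two filter letters — ★`map_nhds_param_pullback` (parametric openness `map (x,y) ↦ (x, f x y) (𝓝 (A x₀', y₀)) = 𝓝 (…)` pulls back along a parameter map `A`
  continuous at `x₀'`) and ★`map_nhds_param_pi` (it survives finite products sharing the parameter);
* §2 parametric bi-translations `(x, g) ↦ (x, m(x)·g)`, `(x, g) ↦ (x, g·m(x))` and the parametric exponential chart `(x, X) ↦ (x, m(x)·Θ X)` in `SU(N)` (shear
  homeomorphisms + ✓`map_expChart_nhds_zero`, pulled back);
* §3 ★★`map_nhds_modelJoint_eq` — dag-n09-w4 g5's jointly-`C^ω` chart model `Φ((V,B),X)` (✓`contDiffAt_modelChart`) gives the JOINT map `(p, X) ↦ (p, Φ(p,X))` the strict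
  derivative `fst.prod DΦ`, onto because the slice `DΦ∘inr` is (✓`sliceDeriv_surjective` = n07-w2's onto central response), hence `map (p,X) ↦ (p,Φ(p,X)) (𝓝 (p₀,0)) = 𝓝 (p₀, Φ(p₀,0))`
  at every window point (Mathlib `HasStrictFDerivAt.map_nhds_eq_of_surj`).

HONEST FRAMING.  Count-neutral inverse-function-theorem bookkeeping BY NAME on the pub-ymgap N09 chart model; nothing of Bałaban's estimates asserted; CHARGE ∕ WREG ∕ S2β ∕
the crux stmt-QuantumFields-20520 are NOT proved here; no summit statement is proved; YM₃ on T³ = rung R3, NOT d = 4, NOT infinite volume, NOT a mass gap, NOT Clay; the YM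
mass gap is NOT proved.

References: T. Bałaban, *Averaging operations for lattice gauge theories*, CMP 98 (1985) 17–51 [Balaban1985Averaging] (Prop. 3 (124) p.36); *Renormalization group approach to
lattice gauge field theories I*, CMP 109 (1987) 249–301 [Balaban1987RG1] ((0.4) p.253, (2.9)–(2.10) pp.266–267); S. Helgason, *Differential Geometry, Lie Groups, and Symmetric
Spaces* (AMS 2001 reprint) [Helgason2000] (Ch. I §1 Thm. 1.14 p.96); N. Bourbaki, *General Topology* Ch. I–IV [BourbakiGT1] (Ch. III §1).
-/

noncomputable section

open scoped Matrix.Norms.L2Operator Topology ContDiff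
open Filter Set Function NormedSpace

namespace Summit.QuantumFields.YangMills.Theorems.FluctuationComparisonRegPrIntLWregChartChargeParam

/-! ## §1  Two filter lemmas: parametric openness pulls back along a continuous parameter map and survives finite products -/

section Filters

variable {X X' Y Z : Type*} [TopologicalSpace X] [TopologicalSpace X'] [TopologicalSpace Y] [TopologicalSpace Z]

/-- **Parametric openness pulls back along a continuous parameter map.**  If `(x, y) ↦ (x, f x y)` maps `𝓝 (A x₀', y₀)` onto
`𝓝 (A x₀', f (A x₀') y₀)` and `A` is continuous at `x₀'`, then `(x', y) ↦ (x', f (A x') y)` maps `𝓝 (x₀', y₀)` onto `𝓝 (x₀', f (A x₀') y₀)`.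
[folklore] -/
theorem map_nhds_param_pullback {f : X → Y → Z} {A : X' → X} {x₀' : X'} {y₀ : Y} (hA : ContinuousAt A x₀')
    (hf : map (fun q : X × Y => (q.1, f q.1 q.2)) (𝓝 (A x₀', y₀)) = 𝓝 (A x₀', f (A x₀') y₀)) :
    map (fun q : X' × Y => (q.1, f (A q.1) q.2)) (𝓝 (x₀', y₀)) = 𝓝 (x₀', f (A x₀') y₀) := by
  apply le_antisymm
  · -- continuity at the point
    have hT : Tendsto (fun q : X × Y => (q.1, f q.1 q.2)) (𝓝 (A x₀', y₀)) (𝓝 (A x₀', f (A x₀') y₀)) := hf.le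
    have hunc : Tendsto (fun q : X × Y => f q.1 q.2) (𝓝 (A x₀', y₀)) (𝓝 (f (A x₀') y₀)) :=
      (continuous_snd.tendsto _).comp hT
    have hin : ContinuousAt (fun q : X' × Y => (A q.1, q.2)) (x₀', y₀) :=
      (hA.comp_of_eq continuousAt_fst rfl).prodMk continuousAt_snd
    have h2 : Tendsto (fun q : X' × Y => f (A q.1) q.2) (𝓝 (x₀', y₀)) (𝓝 (f (A x₀') y₀)) := hunc.comp hin
    exact (continuousAt_fst.prodMk h2 :)
  · refine Filter.le_map fun s hs => ?_
    obtain ⟨u, hu, v, hv, huv⟩ := mem_nhds_prod_iff.1 hs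
    have himg : (fun q : X × Y => (q.1, f q.1 q.2)) '' (univ ×ˢ v) ∈ 𝓝 (A x₀', f (A x₀') y₀) := by
      rw [← hf]; exact image_mem_map (prod_mem_nhds univ_mem hv)
    obtain ⟨u', hu', w, hw, huw⟩ := mem_nhds_prod_iff.1 himg
    refine mem_of_superset (prod_mem_nhds (inter_mem hu (hA.preimage_mem_nhds hu')) hw) ?_
    rintro ⟨x', z⟩ ⟨⟨hx'u, hx'u'⟩, hz⟩
    obtain ⟨⟨x, y⟩, ⟨-, hyv⟩, hq⟩ := huw (mk_mem_prod hx'u' hz)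
    simp only [Prod.mk.injEq] at hq
    obtain ⟨rfl, hfz⟩ := hq
    exact ⟨(x', y), huv (mk_mem_prod hx'u hyv), by simp [hfz]⟩

/-- **Parametric openness survives finite products sharing the parameter.**  If each `(x, y) ↦ (x, f i x y)` maps `𝓝 (x₀, y₀ i)` onto
`𝓝 (x₀, f i x₀ (y₀ i))`, then `(x, y) ↦ (x, fun i => f i x (y i))` maps `𝓝 (x₀, y₀)` onto `𝓝 (x₀, fun i => f i x₀ (y₀ i))`. [folklore] -/
theorem map_nhds_param_pi {ι : Type*} [Fintype ι] {f : ι → X → Y → Z} {x₀ : X} {y₀ : ι → Y}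
    (hf : ∀ i, map (fun q : X × Y => (q.1, f i q.1 q.2)) (𝓝 (x₀, y₀ i)) = 𝓝 (x₀, f i x₀ (y₀ i))) :
    map (fun q : X × (ι → Y) => (q.1, fun i => f i q.1 (q.2 i))) (𝓝 (x₀, y₀)) = 𝓝 (x₀, fun i => f i x₀ (y₀ i)) := by
  apply le_antisymm
  · have hunc : ∀ i, Tendsto (fun q : X × Y => f i q.1 q.2) (𝓝 (x₀, y₀ i)) (𝓝 (f i x₀ (y₀ i))) := fun i =>
      (continuous_snd.tendsto _).comp (hf i).le
    have h2 : Tendsto (fun q : X × (ι → Y) => fun i => f i q.1 (q.2 i)) (𝓝 (x₀, y₀)) (𝓝 (fun i => f i x₀ (y₀ i))) := by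
      refine tendsto_pi_nhds.2 fun i => ?_
      have hin : ContinuousAt (fun q : X × (ι → Y) => (q.1, q.2 i)) (x₀, y₀) :=
        continuousAt_fst.prodMk (((continuous_apply i).continuousAt).comp_of_eq continuousAt_snd rfl)
      exact (hunc i).comp hin
    exact (continuousAt_fst.prodMk h2 :)
  · refine Filter.le_map fun s hs => ?_
    obtain ⟨u, hu, v, hv, huv⟩ := mem_nhds_prod_iff.1 hs
    rw [nhds_pi] at hv
    obtain ⟨I, -, t, ht, hItv⟩ := Filter.mem_pi.1 hv
    have htv : Set.pi univ t ⊆ v := fun x hx => hItv fun i _ => hx i (mem_univ i)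
    have himg : ∀ i, (fun q : X × Y => (q.1, f i q.1 q.2)) '' (univ ×ˢ t i) ∈ 𝓝 (x₀, f i x₀ (y₀ i)) := fun i => by
      rw [← hf i]; exact image_mem_map (prod_mem_nhds univ_mem (ht i))
    choose u' hu' w hw huw using fun i => mem_nhds_prod_iff.1 (himg i)
    refine mem_of_superset (prod_mem_nhds (inter_mem hu ((Filter.iInter_mem).2 hu')) (set_pi_mem_nhds Set.finite_univ fun i _ => hw i)) ?_
    rintro ⟨x, z⟩ ⟨⟨hxu, hxu'⟩, hz⟩
    have hsol : ∀ i, ∃ y : Y, y ∈ t i ∧ f i x y = z i := fun i => by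
      obtain ⟨⟨x₁, y⟩, ⟨-, hyt⟩, hq⟩ := huw i (mk_mem_prod (Set.mem_iInter.1 hxu' i) (hz i (mem_univ i)))
      simp only [Prod.mk.injEq] at hq
      obtain ⟨rfl, hfz⟩ := hq
      exact ⟨y, hyt, hfz⟩
    choose y hyt hyz using hsol
    exact ⟨(x, y), huv (mk_mem_prod hxu (htv fun i _ => hyt i)), by simp [hyz]⟩

end Filters

/-! ## §2  Parametric bi-translations and the parametric exponential chart in `SU(N)` -/

section Transport

open Literature.MathematicalPhysics.QuantumFieldTheory.Balaban1983to89
open Literature.MathematicalPhysics.QuantumFieldTheory.Balaban1983to89.HaarExponentialChart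
open Literature.MathematicalPhysics.QuantumFieldTheory.Balaban1983to89.Node00
open Summit.QuantumFields.YangMills.BalabanUVNodes.N09CentralWindowOpenMapping (map_expChart_nhds_zero)

variable {N : ℕ} [NeZero N] {X : Type*} [TopologicalSpace X]

omit [NeZero N] in
/-- Parametric LEFT translation: `(x, g) ↦ (x, m(x)·g)` maps `𝓝 (x₀, g₀)` onto `𝓝 (x₀, m(x₀)·g₀)` for `m` continuous at `x₀` (shear homeomorphism, pulled back).
[cite: BourbakiGT1, Ch. III §1 no. 1 (bookkeeping)] -/
theorem map_nhds_param_mul_left {m : X → SU N} {x₀ : X} (hm : ContinuousAt m x₀) (g₀ : SU N) :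
    map (fun q : X × SU N => (q.1, m q.1 * q.2)) (𝓝 (x₀, g₀)) = 𝓝 (x₀, m x₀ * g₀) := by
  have hmodel : ∀ k₀ : SU N, map (fun q : SU N × SU N => (q.1, q.1 * q.2)) (𝓝 (k₀, g₀)) = 𝓝 (k₀, k₀ * g₀) := fun k₀ =>
    (Homeomorph.shearMulRight (SU N)).map_nhds_eq (k₀, g₀)
  exact map_nhds_param_pullback (f := fun k g => k * g) hm (hmodel (m x₀))

omit [NeZero N] in
/-- Parametric RIGHT translation: `(x, g) ↦ (x, g·m(x))` maps `𝓝 (x₀, g₀)` onto `𝓝 (x₀, g₀·m(x₀))` for `m` continuous at `x₀`.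
[cite: BourbakiGT1, Ch. III §1 no. 1 (bookkeeping)] -/
theorem map_nhds_param_mul_right {m : X → SU N} {x₀ : X} (hm : ContinuousAt m x₀) (g₀ : SU N) :
    map (fun q : X × SU N => (q.1, q.2 * m q.1)) (𝓝 (x₀, g₀)) = 𝓝 (x₀, g₀ * m x₀) := by
  let e : SU N × SU N ≃ₜ SU N × SU N :=
    { toFun := fun q => (q.1, q.2 * q.1)
      invFun := fun q => (q.1, q.2 * q.1⁻¹)
      left_inv := fun q => by simp
      right_inv := fun q => by simp
      continuous_toFun := continuous_fst.prodMk (continuous_snd.mul continuous_fst)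
      continuous_invFun := continuous_fst.prodMk (continuous_snd.mul continuous_fst.inv) }
  have hmodel : ∀ k₀ : SU N, map (fun q : SU N × SU N => (q.1, q.2 * q.1)) (𝓝 (k₀, g₀)) = 𝓝 (k₀, g₀ * k₀) := fun k₀ =>
    e.map_nhds_eq (k₀, g₀)
  exact map_nhds_param_pullback (f := fun k g => g * k) hm (hmodel (m x₀))

/-- Parametric exponential chart: `(x, X) ↦ (x, m(x)·Θ X)` maps `𝓝 (x₀, 0)` onto `𝓝 (x₀, m(x₀))` for `m` continuous at `x₀`
(`Θ` pushes `𝓝 0` to `𝓝 1`, ✓`map_expChart_nhds_zero`). [cite: Helgason2000, Ch. I §1 Thm. 1.14 (13) p. 96 (bookkeeping)] -/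
theorem map_nhds_param_mul_expChart {m : X → SU N} {x₀ : X} (hm : ContinuousAt m x₀) :
    map (fun q : X × (specialUnitaryLogChart (Fin N)).lie => (q.1, m q.1 * (isChartRep_specialUnitaryGroup (n := Fin N)).expChart q.2))
      (𝓝 (x₀, 0)) = 𝓝 (x₀, m x₀) := by
  have h1 : map (fun q : X × (specialUnitaryLogChart (Fin N)).lie => (q.1, (isChartRep_specialUnitaryGroup (n := Fin N)).expChart q.2))
      (𝓝 (x₀, 0)) = 𝓝 (x₀, (1 : SU N)) := by
    rw [nhds_prod_eq, nhds_prod_eq, show (fun q : X × (specialUnitaryLogChart (Fin N)).lie =>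
        (q.1, (isChartRep_specialUnitaryGroup (n := Fin N)).expChart q.2)) = Prod.map id (isChartRep_specialUnitaryGroup (n := Fin N)).expChart from rfl,
      ← Filter.prod_map_map_eq', Filter.map_id, map_expChart_nhds_zero]
  have h2 := map_nhds_param_mul_left hm (1 : SU N)
  rw [mul_one] at h2
  rw [show (fun q : X × (specialUnitaryLogChart (Fin N)).lie => (q.1, m q.1 * (isChartRep_specialUnitaryGroup (n := Fin N)).expChart q.2)) =
      (fun q : X × SU N => (q.1, m q.1 * q.2)) ∘ (fun q : X × (specialUnitaryLogChart (Fin N)).lie =>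
        (q.1, (isChartRep_specialUnitaryGroup (n := Fin N)).expChart q.2)) from rfl,
    ← Filter.map_map, h1, h2]

end Transport

/-! ## §3  The jointly analytic chart model is JOINTLY open: `(p, X) ↦ (p, Φ(p, X))` at `((V(U), ↑W₁), 0)` (inverse-function theorem, parameters carried) -/

section Model

open Literature.MathematicalPhysics.QuantumFieldTheory.Balaban1983to89
open Literature.MathematicalPhysics.QuantumFieldTheory.Balaban1983to89.HaarExponentialChart
open Literature.MathematicalPhysics.QuantumFieldTheory.Balaban1983to89.HaarExponentialChart.IsChartRep
open Literature.MathematicalPhysics.QuantumFieldTheory.Balaban1983to89.BlockAveraging (Small Idx avgFun loopHol)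
open Literature.MathematicalPhysics.QuantumFieldTheory.Balaban1983to89.BlockAveragingHaarAC (centralBond pre post openHol IsCentral)
open Literature.MathematicalPhysics.QuantumFieldTheory.Balaban1983to89.BlockAveragingEMLHaarAC (fibreFamily fibreMap FibreSmall fibreGuard
  fibreFamily_of_isCentral fibreFamily_of_not_isCentral dist1_fibreFamily_of_not_isCentral avgFun_update_centralBond_self isOpen_fibreGuard)
open Literature.MathematicalPhysics.QuantumFieldTheory.Balaban1983to89.ExpMeanLog (eml expMeanLogSU deltaSU)
open Literature.MathematicalPhysics.QuantumFieldTheory.Balaban1983to89.MatrixLog (mlog mlog_one)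
open Literature.MathematicalPhysics.QuantumFieldTheory.Balaban1983to89.Node00
open Literature.MathematicalPhysics.QuantumLattice (fundamentalRep fundamentalRep_apply continuous_fundamentalRep)
open Summit.QuantumFields.YangMills.BalabanUVNodes.N09CentralWindowChart
  (contDiffAt_modelE contDiffAt_modelChart coe_fibreMap_eq_modelE modelChart_apply_eq_logChart fibreSmall_of_mem_window coe_expChart_SU)
open Summit.QuantumFields.YangMills.BalabanUVNodes.N09CentralWindowNondegenerate (sliceDeriv_surjective)
open Summit.QuantumFields.YangMills.BalabanUVNodes.N09CentralWindowOpenMapping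
  (map_expChart_nhds_zero map_mul_expChart_nhds_zero continuousAt_fibreMap_of_fibreSmall map_nhds_modelSlice_eq)

variable {N : ℕ} [NeZero N] {P : Params} {j : ℕ}

/-- ★★ **THE CHART MODEL IS JOINTLY OPEN AT A WINDOW POINT**: `(p, X) ↦ (p, Φ(p, X))` maps `𝓝 ((V(U), ↑W₁), 0)` onto `𝓝 ((V(U), ↑W₁), Φ((V(U),↑W₁), 0))` —
`Φ` is `C^ω` JOINTLY (✓`contDiffAt_modelChart`), so `(p, X) ↦ (p, Φ(p,X))` has strict derivative `fst.prod DΦ`, onto because the slice `DΦ∘inr` is (✓`sliceDeriv_surjective`);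
Mathlib's `HasStrictFDerivAt.map_nhds_eq_of_surj`. [cite: Balaban1985Averaging, Prop. 3 (124) p.36; Balaban1987RG1, (0.4) p.253 and (2.10) p.267] -/
theorem map_nhds_modelJoint_eq (hj : j + 1 ≤ P.m + P.K) (U : GaugeField P j (SU N)) (c : PBond P (j + 1)) {α : ℝ}
    (hα24 : α ≤ 1 / 24) (hαδ : α < deltaSU (Fin N)) (hαL : 157 * α < ((P.L : ℝ) ^ (P.d - 1))⁻¹)
    (Φ : ((Idx P → Matrix (Fin N) (Fin N) ℂ) × Matrix (Fin N) (Fin N) ℂ) × (specialUnitaryLogChart (Fin N)).lie → (specialUnitaryLogChart (Fin N)).lie)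
    (hΦ : ∀ p, Φ p = HaarExpChartLocal.proj (specialUnitaryLogChart (Fin N))
      (mlog (star ((fun V A => eml (fun i : Idx P => if IsCentral c i then (1 : Matrix (Fin N) (Fin N) ℂ) else V i * star A) * A) p.1.1 p.1.2) *
        (fun V A => eml (fun i : Idx P => if IsCentral c i then (1 : Matrix (Fin N) (Fin N) ℂ) else V i * star A) * A) p.1.1
          (p.1.2 * exp ((p.2 : (specialUnitaryLogChart (Fin N)).lie) : Matrix (Fin N) (Fin N) ℂ)))))
    {W₁ : SU N} (hW₁ : ∀ i : Idx P, dist1 (fibreFamily U c W₁ i) ≤ α) :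
    map (fun q : ((Idx P → Matrix (Fin N) (Fin N) ℂ) × Matrix (Fin N) (Fin N) ℂ) × (specialUnitaryLogChart (Fin N)).lie => (q.1, Φ q))
      (𝓝 (((fun i => ((openHol U c i : SU N) : Matrix (Fin N) (Fin N) ℂ)), (W₁ : Matrix (Fin N) (Fin N) ℂ)), 0)) =
      𝓝 (((fun i => ((openHol U c i : SU N) : Matrix (Fin N) (Fin N) ℂ)), (W₁ : Matrix (Fin N) (Fin N) ℂ)),
        Φ (((fun i => ((openHol U c i : SU N) : Matrix (Fin N) (Fin N) ℂ)), (W₁ : Matrix (Fin N) (Fin N) ℂ)), 0)) := by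
  haveI : Nonempty (Fin N) := ⟨⟨0, Nat.pos_of_ne_zero (NeZero.ne N)⟩⟩
  have hfs : FibreSmall (expMeanLogSU (n := Fin N)) U c W₁ := fibreSmall_of_mem_window U c hαδ hW₁
  -- joint smoothness at `((V(U), ↑W₁), 0)` (as in ✓`map_nhds_modelSlice_eq`)
  have h1 : ∀ i, ¬ IsCentral c i → ‖((openHol U c i : SU N) : Matrix (Fin N) (Fin N) ℂ) * star (W₁ : Matrix (Fin N) (Fin N) ℂ) - 1‖ < 1 := by
    intro i hi
    have h := hfs i
    rw [dist1_fibreFamily_of_not_isCentral U c W₁ i hi] at h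
    exact h.trans (show ExpMeanLog.deltaSU (Fin N) < 1 from (min_le_left _ _).trans_lt (by norm_num))
  have hexp0 : (W₁ : Matrix (Fin N) (Fin N) ℂ) * exp (((0 : (specialUnitaryLogChart (Fin N)).lie) : Matrix (Fin N) (Fin N) ℂ)) = (W₁ : Matrix (Fin N) (Fin N) ℂ) := by
    rw [ZeroMemClass.coe_zero, NormedSpace.exp_zero, mul_one]
  have h2 : ∀ i, ¬ IsCentral c i → ‖((openHol U c i : SU N) : Matrix (Fin N) (Fin N) ℂ) *
      star ((W₁ : Matrix (Fin N) (Fin N) ℂ) * exp (((0 : (specialUnitaryLogChart (Fin N)).lie) : Matrix (Fin N) (Fin N) ℂ))) - 1‖ < 1 := by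
    rw [hexp0]; exact h1
  have hEW : (fun V A => eml (fun i : Idx P => if IsCentral c i then (1 : Matrix (Fin N) (Fin N) ℂ) else V i * star A) * A)
      (fun i => ((openHol U c i : SU N) : Matrix (Fin N) (Fin N) ℂ)) (W₁ : Matrix (Fin N) (Fin N) ℂ) =
      ((fibreMap (expMeanLogSU (n := Fin N)) U c W₁ : SU N) : Matrix (Fin N) (Fin N) ℂ) :=
    (coe_fibreMap_eq_modelE U c _ (fun _ _ => rfl) hfs).symm
  have h3 : ‖star ((fun V A => eml (fun i : Idx P => if IsCentral c i then (1 : Matrix (Fin N) (Fin N) ℂ) else V i * star A) * A)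
        (fun i => ((openHol U c i : SU N) : Matrix (Fin N) (Fin N) ℂ)) (W₁ : Matrix (Fin N) (Fin N) ℂ)) *
      (fun V A => eml (fun i : Idx P => if IsCentral c i then (1 : Matrix (Fin N) (Fin N) ℂ) else V i * star A) * A)
        (fun i => ((openHol U c i : SU N) : Matrix (Fin N) (Fin N) ℂ))
          ((W₁ : Matrix (Fin N) (Fin N) ℂ) * exp (((0 : (specialUnitaryLogChart (Fin N)).lie) : Matrix (Fin N) (Fin N) ℂ))) - 1‖ < 1 := by
    rw [hexp0, hEW, star_coe_mul_coe_SU, sub_self, norm_zero]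
    exact one_pos
  have hΦdiff := contDiffAt_modelChart (N := N) c _ (fun _ _ => rfl) Φ hΦ h1 h2 h3
  have hD := hΦdiff.hasStrictFDerivAt (by simp)
  -- the joint map `(p, X) ↦ (p, Φ (p, X))` and its onto strict derivative `fst.prod DΦ`
  have hJ := (hasStrictFDerivAt_fst (𝕜 := ℝ)
    (p := ((((fun i => ((openHol U c i : SU N) : Matrix (Fin N) (Fin N) ℂ)), (W₁ : Matrix (Fin N) (Fin N) ℂ)) :
      (Idx P → Matrix (Fin N) (Fin N) ℂ) × Matrix (Fin N) (Fin N) ℂ), (0 : (specialUnitaryLogChart (Fin N)).lie)))).prodMk hD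
  have hsurj := sliceDeriv_surjective hj U c hα24 hαδ hαL _ (fun _ _ => rfl) Φ hΦ hW₁
  refine hJ.map_nhds_eq_of_surj (LinearMap.range_eq_top.2 ?_)
  rintro ⟨e, y⟩
  obtain ⟨dX, hdX⟩ := hsurj (y - fderiv ℝ Φ (((fun i => ((openHol U c i : SU N) : Matrix (Fin N) (Fin N) ℂ)), (W₁ : Matrix (Fin N) (Fin N) ℂ)), 0) (e, 0))
  refine ⟨(e, dX), ?_⟩
  have hsplit : ((e, dX) : ((Idx P → Matrix (Fin N) (Fin N) ℂ) × Matrix (Fin N) (Fin N) ℂ) × (specialUnitaryLogChart (Fin N)).lie) =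
      (e, 0) + (ContinuousLinearMap.inr ℝ ((Idx P → Matrix (Fin N) (Fin N) ℂ) × Matrix (Fin N) (Fin N) ℂ) (specialUnitaryLogChart (Fin N)).lie) dX := by
    simp
  simp only [ContinuousLinearMap.coe_coe, ContinuousLinearMap.prod_apply, ContinuousLinearMap.coe_fst', Prod.mk.injEq, true_and]
  rw [hsplit, map_add, ← ContinuousLinearMap.comp_apply, hdX]
  simp

end Model

end Summit.QuantumFields.YangMills.Theorems.FluctuationComparisonRegPrIntLWregChartChargeParam

end
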